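import Summits.HodgeConjecture.HodgeConjecture.Theorems.F0P6aSheetPointTwistedMarkingInputs        -- ★ p850665 σ1-UNPACK `exists_twistedMarkingInputs_of_ringActionReading` (+ `map_Mρ_eq_conj`, `mk_jOfSiegel_inv_mul_eq_mk`)
import Literature.AlgebraicGeometry.ModuliOfAbelianVarieties.SiegelAdelicMarkingSerreTensorCover     -- ★ p850517 (brings ★ p849685 `exists_marking_of_idealKernel`, ★ `serreCover_rows_of_presentation`, `dim_toAffine_toAbelianVariety_eq_of_isOfRelDim`)
import Literature.AlgebraicGeometry.AbelianSchemes.SerreTranslateCoverLeg                           -- ★ `idealKernelLaw_baseChangeHom`, `surjective_baseChangeHom_left`, `i_baseChange_comp_baseChangeHom`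
import Literature.AlgebraicGeometry.ModuliOfAbelianVarieties.SiegelAdelicMarkingPrincipalRationalMove -- ★ (this organ, generic half) `SiegelAdelicMarking.exists_principal_rationalMove`, `exists_intMatrix_of_reading_of_mem_one`
import Literature.AlgebraicGeometry.Motives.AlgPointsMapSurjectiveAlgClosed                         -- ★ `AlgPoints.map_surjective_of_surjective_of_isAlgClosed'`
import Literature.AlgebraicGeometry.AbelianSchemes.AbelianSchemeFibreHom                             -- ★ `fibreHom`, `fibreHom_comp`
import HarnessLib

/-!
# DEAL #42 — THE MARKED SERRE-TENSOR FIBRE AT A SIEGEL POINT (the `m₂` of (B1)-tower ∕ (B2) `hε₂` ∕ (B3) (R-CM), road (γ′))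
# ([Shimura 1998] §18.6: `A ⊗ 𝔞⁻¹ = ℂ^g ∕ 𝔞⁻¹Λ` marked by the translate; [Milne 2005] Thm. 6.11, Lemma 5.13: principal representatives)

Cell `hodgecm-mathlib` (D-0151), FLOOR 0, P6 «MOD programme», crux hLiu418 (stmt-HodgeConjecture-24832, `--supports`, count-neutral), line «L4», closer
`Lines/F0_P6a_StubESHEET.lean`, socket `stub_SHEET`, ROAD OF RECORD v3 = (γ′) «Serre tensor over `X`, classified» (LA4-plan (g2) 08:48:23Z; LEG-E(γ′) LA7-p01 (g4)
09:09:36Z tokens): `X := (M_Kc) ⊗_F Fᵢ`, `P := univ ×_{𝓜} X` along the slice `ε`, the `𝒪_F`-action `ρ` reading through the chart (`RingActionReading C ε ρ`), the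
GLOBAL twisted family `B := serreTensor ρ E′ hE′` over `X.left` with its cover `c₀ := serreTranslate ρ E′ hE′ P_m` (★ p850615 presentation rows `hP hQ hQP hPQ hspan`,
scalar `ν`).  **DEAL #42 (LA4-plan (g2) 09:11:38Z (a) + 09:15:51Z; ONE PRODUCER, THREE CONSUMERS):** at a complex point `x` of `X` over `τE` with flat shadow `Pflat`,
MARK THE FIBRE `B_x := (B.fibre x.left)` —
* §1 **`exists_markedSerreTensorFibre`** (engine currency, the input of #38 [C] ∕ [A]): σ1-UNPACK (★ p850665) at `x` ⇒ `(v, a, k, m, Θ, Λ)` with all its readings, and the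
  Shimura marking `mB` of `B_x` by `[J(C.Z a v), r′ · ũ_V(1,z)]` (`r′ := (q a)_𝔸⁻¹ · b a`) with `mB.r = c₀,x ∘ m.r` (★ p849685 `exists_marking_of_idealKernel` on the
  cover `fibreHom c₀ x.left`, whose kernel law and surjectivity are the GLOBAL rows (t1′)(surj) of ★ `serreCover_rows_of_presentation` READ AT `x` — ★
  `idealKernelLaw_baseChangeHom`, ★ `surjective_baseChangeHom_left`), and the twisted action `act₂ b := fibreHom ((serreAction ρ E′ hE′).i b) x.left` READING
  `C.Mρ a b` through `mB` ((t4) at `x`);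
* §2 **`exists_markedSerreTensorFibre_principal`** (the EIGHT NAMES of (R-CM) ★ p850737 ∕ (R-CM-3) LA6-p02 ∕ #41-tower LA5-p02): the same fibre marked at a
  PRINCIPAL SIEGEL representative — `Z₂ ∈ 𝔥_g`, `r₂ ∈ K_δ(1)`, `m₂ : SiegelAdelicMarking ⟨J(Z₂), _⟩ r₂ B_x`, a mover `q′ = (q a)·q_m ∈ GSp_δ(ℚ)` with
  `q′_ℝ⁻¹ (C.J v) q′_ℝ = J(Z₂)`, `q′_𝔸 · r₂ K_δ(N) = C.b a · ũ_V(1,z) K_δ(N)`, INTEGER matrices `M₂ b` with `(M₂ b)_ℚ = q′⁻¹ ρ₀(b) q′` read by `act₂` through `m₂`, and the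
  explicit cover reading `m₂.r w = c₀,x (m₀.r (q_m w))` against σ1's principal marking `m₀` of `P_x` by `[J(C.Z a v), rep(piece a)]` (★ `exists_eq_mk_jOfSiegel` + ★
  `SiegelShimuraSet.mk_eq_mk_iff` + ★ `rationalMove` + ★ `exists_of_eq`; integrality of `M₂` because a reading through a marking at `r₂ ∈ K_δ(1)` preserves
  `Λ_{r₂} = ℤ^{2g}`, ★ `SiegelAdelicMarkingPrincipalRationalMove` §0).
[A] («`IsAdmissibleAt` of the pulled-back tuple at `(C.Z a v, r′ũ)`», LA4-p02 (g2) ★ p850754∕p850771 §4 currency `Pₓ`) is assembled by its consumer from §1 + the #41 tower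
(`Θ₂, Λ₂, hΛ₂`) by ★ `isAdmissibleAt_of_levelReading` ∕ `isAdmissibleAt_of_fibreIso`; this file stays in FIBRE-AT-`x` currency (`(serreTensor ρ E′ hE′).fibre x.left`).
HONEST LABEL: HC_CM is proved only modulo the 7 printed citations (2 remaining: hLiu418 24832, h413 24833) until rung 0 closes; this file closes no statement item.

## References
* [Shimura1998] G. Shimura, *Abelian Varieties with Complex Multiplication and Modular Functions* (1998), §18.3 pp. 122–123, §18.6 pp. 124–127.
* [Milne2005ShimuraVarieties] J. S. Milne, *Introduction to Shimura varieties* (2005), §5 Lemma 5.13 p. 57, §6 Thm. 6.11 pp. 74–75, §12 (63) p. 116.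
* [Deligne1971TravauxShimura] P. Deligne, *Travaux de Shimura* (1971), 4.11–4.12 pp. 148–149.
* [RapoportSmithlingZhang2020Diagonal] M. Rapoport, B. Smithling, W. Zhang (2020), §3.2 p. 11 (the sheets of `M ⊗_F Fᵢ` and their twists).
* [GortzWedhorn2020] U. Görtz, T. Wedhorn, *Algebraic Geometry I*, 2nd ed. (2020), (4.15) p. 116, Def. 4.45 (2) p. 117.
-/

set_option autoImplicit false

noncomputable section

namespace Summit.HodgeConjecture.HodgeConjecture.Theorems.F0P6aSerreTensorFibreMarkedAtSiegelPoint

set_option linter.dupNamespace false  -- `Summit.HodgeConjecture.HodgeConjecture.…` BY DESIGN (D-0017)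

open CategoryTheory CategoryTheory.Limits NumberField IsDedekindDomain MulAction Matrix AlgebraicGeometry
open scoped Matrix ComplexOrder MonObj nonZeroDivisors
open Literature.AlgebraicGeometry.Motives (SchemeOver AlgPoints ComplexPoints specOver)
open Literature.AlgebraicGeometry.Motives.AbelianVariety (bcSpec)
open Literature.AlgebraicGeometry.AbelianSchemes (PolarizedAbelianSchemeWithLevel AbelianSchemeOver)
open Literature.AlgebraicGeometry.AbelianSchemes.AbelianSchemeOver (serreTensor serreTranslate serreAction isMonHom_serreTranslate baseChangeHom fibreHom)
open Literature.AlgebraicGeometry.ModuliOfAbelianVarieties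
open Literature.AlgebraicGeometry.ShimuraVarieties Literature.AlgebraicGeometry.ShimuraVarieties.UnitaryCanonicalModel
open Literature.AlgebraicGeometry.ShimuraVarieties.UnitaryCurve Literature.AlgebraicGeometry.ShimuraVarieties.UnitaryCurve.AuxV
open Literature.NumberTheory.Automorphic Literature.NumberTheory.Automorphic.UnitaryGroup
open Literature.NumberTheory.Automorphic.Liu2021.AppendixC (C5.OpenCompactSubgroup C5.SmallLevel)
open Literature.NumberTheory.Adeles (latticeOfGL)
open Literature.AlgebraicGeometry.ShimuraVarieties.UnitaryCanonicalModel.Aux (torusFinAdelic)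
open Summit.HodgeConjecture.HodgeConjecture.Cruxes.HLiu418.F0P6aPELWitnessE (GSAdele IsCMTypeThrough mOf AuxChartGS)
open Summit.HodgeConjecture.HodgeConjecture.Cruxes.HLiu418.F0P6aStubE6 (Reads RingActionReading)
open Summit.HodgeConjecture.HodgeConjecture.Cruxes.HLiu418.F0P6aChartFramePin (IsChartOfFrame)
open Summit.HodgeConjecture.HodgeConjecture.Theorems.F0P6aSheetPointTwistedMarkingInputs (map_Mρ_eq_conj exists_twistedMarkingInputs_of_ringActionReading)

variable {F : Type} [Field F] [NumberField F] [IsCMField F] {ι₁ : F →+* ℂ} {Jstar : Matrix (Fin 2) (Fin 2) F}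
  {K₀ : C5.OpenCompactSubgroup (GSAdele F Jstar)} {S : RecordSystemGS F Jstar ι₁ K₀} {Kc : C5.SmallLevel K₀}
  {Fi : Type} [Field Fi] [NumberField Fi] [Algebra F Fi] {τE : Fi →+* ℂ} {Φ : Set (F →+* ℂ)}

/-! ### §1 THE HEAD IN ENGINE CURRENCY: `B_x` marked by `[J(C.Z a v), r′ · ũ_V(1,z)]`, reading `C.Mρ a` -/

set_option maxHeartbeats 800000 in -- the statement re-binds σ1-UNPACK's package (thirteen clauses) plus the two Serre clauses
/-- **DEAL #42 §1 — THE MARKED SERRE-TENSOR FIBRE (engine currency).**  In the setting of ★ σ1-UNPACK (chart `C` pinned on `Fr`, pull-back `P := univ ×_{𝓜} X` along `ε`,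
`𝒪_F`-action `ρ` with `RingActionReading C ε ρ`, complex point `x` over `τE` with flat shadow `Pflat`, `𝔞 ≠ 0`, torus idèle `z` with `[z] = 𝔞⁻¹`), and for a Serre
presentation `(E′, P_m, Q_m)` of `𝔞` with scalar `ν ≠ 0` (`E′P_m = P_m`, `Q_mE′ = Q_m`, `Q_mP_m = ν`, `P_mQ_m = νE′`, coordinates of `P_m` generating `𝔞` — ★ p850615's
rows; `B := serreTensor ρ E′ hE′` then has relative dimension `g`, ★ `isOfRelDim_serreTensor`): σ1's data `(v, a, k, m, Θ, Λ)` at `x` WITH ALL THIRTEEN READINGS (verbatim ★ p850665), AND a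
marking `mB` of the fibre `B_x` by `[J(C.Z a v), r′ · ũ_V(1,z)]`, `r′ := (q a)_𝔸⁻¹ · b(a)`, such that `mB.r w = (c₀)_x (m.r w)` for the cover `c₀ := serreTranslate ρ E′ hE′ P_m`
and the twisted action `b ↦ ((serreAction ρ E′ hE′).i b)_x` reads `C.Mρ a b` through `mB`.  Shimura's «`A ⊗ 𝔞⁻¹ = ℂ^g∕𝔞⁻¹Λ`, marked by the translate» at one complex
fibre of the GLOBAL twist. [cite: Shimura1998, §18.6 pp. 124–127] [cite: Milne2005ShimuraVarieties, §6 Thm. 6.11 pp. 74–75, §12 (63) p. 116]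
[cite: RapoportSmithlingZhang2020Diagonal, §3.2 p. 11] [cite: GortzWedhorn2020, (4.15) p. 116 and Definition 4.45 (2) p. 117] -/
theorem exists_markedSerreTensorFibre (hΦ : IsCMTypeThrough ι₁ Φ) (C : AuxChartGS F ι₁ Jstar K₀ S Kc Fi τE Φ)
    (ξ : F) (kFr : ℕ) (Fr : SymplecticFrameV F (RingHom.id F) Jstar ((kFr : ℚ) • ξ) C.g C.δ) (hpin : IsChartOfFrame hΦ C ξ kFr Fr)
    (ε : (Literature.AlgebraicGeometry.Motives.baseChange F Fi).obj (S.M.obj Kc) ⟶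
        (Literature.AlgebraicGeometry.Motives.baseChange ℚ Fi).obj C.𝓜.M)
    (ρ : AbelianSchemeOver.RingAction (𝓞 F) (C.𝓜.univ.baseChange (ε.left ≫ pullback.fst C.𝓜.M.hom (bcSpec ℚ Fi))).A)
    [IsCommMonObj (C.𝓜.univ.baseChange (ε.left ≫ pullback.fst C.𝓜.M.hom (bcSpec ℚ Fi))).A.X]
    (hρ : RingActionReading C ε ρ)
    (x : letI : Algebra Fi ℂ := τE.toAlgebra; ComplexPoints ((Literature.AlgebraicGeometry.Motives.baseChange F Fi).obj (S.M.obj Kc)))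
    (Pflat : letI : Algebra F ℂ := ι₁.toAlgebra; ComplexPoints (S.M.obj Kc))
    (hx : Pflat.left = x.left ≫ pullback.fst (S.M.obj Kc).hom (bcSpec F Fi))
    (𝔞 : Ideal (𝓞 F)) (h𝔞 : 𝔞 ≠ ⊥) (z : ↥(torusFinAdelic F))
    (hz : FiniteAdeleRing.toFractionalIdeal (𝓞 F) F (z : (FiniteAdeleRing (𝓞 F) F)ˣ) = ((𝔞 : FractionalIdeal (𝓞 F)⁰ F))⁻¹)
    -- the Serre presentation of `𝔞` with scalar `ν` (★ p850615's rows) and the relative dimension of the twist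
    {mS : ℕ} (E' : Matrix (Fin mS) (Fin mS) (𝓞 F)) (hE' : E' * E' = E') (Pm : Matrix (Fin mS) (Fin 1) (𝓞 F)) (Qm : Matrix (Fin 1) (Fin mS) (𝓞 F))
    {ν : ℕ} (hν : ν ≠ 0) (hP : E' * Pm = Pm) (hQ : Qm * E' = Qm) (hQP : Qm * Pm = Matrix.scalar (Fin 1) ((ν : ℕ) : 𝓞 F))
    (hPQ : Pm * Qm = Matrix.scalar (Fin mS) ((ν : ℕ) : 𝓞 F) * E') (hspan : Ideal.span (Set.range fun j => Pm j 0) = 𝔞) :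
    letI P := C.𝓜.univ.baseChange (ε.left ≫ pullback.fst C.𝓜.M.hom (bcSpec ℚ Fi))
    haveI := isMonHom_serreTranslate ρ E' hE' Pm
    ∃ (v : Fin 2 → ℂ) (hv : v ∈ negCone (Jstar.map ι₁)) (a : GSAdele F Jstar) (k : ↥(gspFinAdelic C.δ))
      (m : SiegelAdelicMarking ⟨SiegelModuli.jOfSiegel C.δ (C.Z a v), SiegelComplexRecordSystem.jOfSiegel_mem_C0pm C.hδ.1 (C.Z_mem a v hv)⟩
        ((gspRationalToFinAdelic C.δ (C.q a))⁻¹ * C.b a) (P.A.fibre x.left).toAbelianVariety)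
      (Θ : Literature.AlgebraicGeometry.Motives.CartierDivisor (P.A.fibre x.left).toAbelianVariety.X.left)
      (Λ : P.level.SymplecticLift x.left Θ C.δ)
      (mB : SiegelAdelicMarking ⟨SiegelModuli.jOfSiegel C.δ (C.Z a v), SiegelComplexRecordSystem.jOfSiegel_mem_C0pm C.hδ.1 (C.Z_mem a v hv)⟩
        ((gspRationalToFinAdelic C.δ (C.q a))⁻¹ * C.b a * auxToGspFinV Fr (1, z)) ((serreTensor ρ E' hE').fibre x.left).toAbelianVariety),
      -- σ1-UNPACK's package (verbatim ★ p850665): the representative and the mover՚s `k`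
      (letI : Algebra F ℂ := ι₁.toAlgebra; S.pts Kc Pflat) = ShimuraSetGS.mk F Jstar ι₁ Kc.1.1 v hv a ∧
      k ∈ principalLevelSubgroup C.δ C.N ∧
      C.rep (C.piece a) = (gspRationalToFinAdelic C.δ (C.q a))⁻¹ * C.b a * k⁻¹ ∧
      Θ.IsAmple ∧ P.A.IsLambdaOfAt x.left P.D P.pol.lam Θ ∧
      (∀ ⦃M : ℕ⦄, C.N ∣ M → M ≠ 0 → ∀ (y : Fin C.g ⊕ Fin C.g → ZMod M) (w : Fin C.g ⊕ Fin C.g → ℚ),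
        AdelicCongr (((C.rep (C.piece a))⁻¹ : ↥(gspFinAdelic C.δ)) : GL (Fin C.g ⊕ Fin C.g) finAdeleQ) 1 w (fun i => ((y i).val : ℚ) / M) →
          ((Λ.lift M (Multiplicative.ofAdd y)) : (P.A.fibre x.left).toAbelianVariety.Points ℂ) = m.r w) ∧
      m.γ = 1 ∧ (∀ w : Fin C.g ⊕ Fin C.g → ℝ, m.Ψ w = siegelPeriodMap C.δ (C.Z a v) w) ∧
      (P.A.baseChange x.left).IsOfRelDim C.g ∧
      (∀ (b : 𝓞 F) (w : Fin C.g ⊕ Fin C.g → ℚ),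
        haveI := ρ.isMonHom b
        AlgPoints.map (fibreHom (ρ.i b) x.left).hom.hom.hom (m.r w) = m.r (((C.Mρ a b).map (Int.cast : ℤ → ℚ)) *ᵥ w)) ∧
      (∀ w : Fin C.g ⊕ Fin C.g → ℚ,
        w ∈ latticeOfGL ((((gspRationalToFinAdelic C.δ (C.q a))⁻¹ * C.b a : ↥(gspFinAdelic C.δ))) : GL (Fin C.g ⊕ Fin C.g) finAdeleQ) →
        ∀ b ∈ 𝔞, ((C.Mρ a b).map (Int.cast : ℤ → ℚ)) *ᵥ w ∈
          latticeOfGL ((((gspRationalToFinAdelic C.δ (C.q a))⁻¹ * C.b a : ↥(gspFinAdelic C.δ))) : GL (Fin C.g ⊕ Fin C.g) finAdeleQ)) ∧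
      (∀ w : Fin C.g ⊕ Fin C.g → ℚ,
        w ∈ latticeOfGL ((((gspRationalToFinAdelic C.δ (C.q a))⁻¹ * C.b a * auxToGspFinV Fr (1, z) : ↥(gspFinAdelic C.δ))) :
            GL (Fin C.g ⊕ Fin C.g) finAdeleQ) ↔
          ∀ b ∈ 𝔞, ((C.Mρ a b).map (Int.cast : ℤ → ℚ)) *ᵥ w ∈
            latticeOfGL ((((gspRationalToFinAdelic C.δ (C.q a))⁻¹ * C.b a : ↥(gspFinAdelic C.δ))) : GL (Fin C.g ⊕ Fin C.g) finAdeleQ)) ∧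
      SiegelShimuraSet.mk C.δ (principalLevelSubgroup C.δ C.N)
          ⟨SiegelModuli.jOfSiegel C.δ (C.Z a v), SiegelComplexRecordSystem.jOfSiegel_mem_C0pm C.hδ.1 (C.Z_mem a v hv)⟩
          ((gspRationalToFinAdelic C.δ (C.q a))⁻¹ * C.b a * auxToGspFinV Fr (1, z)) =
        SiegelShimuraSet.mk C.δ (principalLevelSubgroup C.δ C.N) ⟨C.J v, C.hJ v hv⟩ (C.b a * auxToGspFinV Fr (1, z)) ∧
      -- THE SERRE CLAUSES: the marking of `B_x` reads the cover as `id` on `V`, and the twisted action reads `C.Mρ a` through it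
      (∀ w : Fin C.g ⊕ Fin C.g → ℚ, mB.r w = AlgPoints.map (fibreHom (serreTranslate ρ E' hE' Pm) x.left).hom.hom.hom (m.r w)) ∧
      (∀ (b : 𝓞 F) (w : Fin C.g ⊕ Fin C.g → ℚ),
        haveI := (serreAction ρ E' hE').isMonHom b
        AlgPoints.map (fibreHom ((serreAction ρ E' hE').i b) x.left).hom.hom.hom (mB.r w) = mB.r (((C.Mρ a b).map (Int.cast : ℤ → ℚ)) *ᵥ w)) := by
  letI iFi : Algebra Fi ℂ := τE.toAlgebra
  letI iF : Algebra F ℂ := ι₁.toAlgebra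
  haveI hc₀ : IsMonHom (serreTranslate ρ E' hE' Pm) := isMonHom_serreTranslate ρ E' hE' Pm
  -- σ1-UNPACK at `x` (★ p850665), destructured one binder at a time (tactic hygiene: `rcases` on an application term is 20× dearer here)
  have hσ := exists_twistedMarkingInputs_of_ringActionReading hΦ C ξ kFr Fr hpin ε ρ hρ x Pflat hx 𝔞 h𝔞 z hz
  obtain ⟨v, hσ⟩ := hσ
  obtain ⟨hv, hσ⟩ := hσ
  obtain ⟨a, hσ⟩ := hσ
  obtain ⟨k, hσ⟩ := hσ
  obtain ⟨hZv, hσ⟩ := hσ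
  obtain ⟨m, hσ⟩ := hσ
  obtain ⟨Θ, hσ⟩ := hσ
  obtain ⟨Λ, hσ⟩ := hσ
  obtain ⟨hpts, hk, hrepk, hample, hlam, hlvl, hγ, hΨ, hA, hread, hint, hr, hcls⟩ := hσ
  -- the presentation-only GLOBAL rows of the Serre cover (any base): (t1′) kernel law on all `T`-points, (surj), (t4) equivariance
  have hrows := AbelianSchemeOver.serreCover_rows_of_presentation ρ E' hE' Pm Qm hν hP hQ hQP hPQ hspan
  obtain ⟨-, t1', hsurj, -, t4⟩ := hrows
  -- `dim B_x = g` (the twist has relative dimension `g`, ★ `isOfRelDim_serreTensor`, from `univ.relDim`)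
  have hrel : (serreTensor ρ E' hE').IsOfRelDim C.g :=
    AbelianSchemeOver.isOfRelDim_serreTensor ρ E' hE' Pm Qm hν hP hQ hQP hPQ
      (C.𝓜.univ.baseChange (ε.left ≫ pullback.fst C.𝓜.M.hom (bcSpec ℚ Fi))).relDim
  have hdim : ((serreTensor ρ E' hE').fibre x.left).toAbelianVariety.dim = C.g :=
    AbelianSchemeOver.dim_toAffine_toAbelianVariety_eq_of_isOfRelDim ((serreTensor ρ E' hE').baseChange x.left) (hrel.baseChange x.left)
  -- the cover and the action READ AT `x`, as homomorphisms of complex abelian varieties (`(fibreHom f s).hom.hom.hom = baseChangeHom f s`, `rfl`)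
  let c : ((C.𝓜.univ.baseChange (ε.left ≫ pullback.fst C.𝓜.M.hom (bcSpec ℚ Fi))).A.fibre x.left).toAbelianVariety ⟶
      ((serreTensor ρ E' hE').fibre x.left).toAbelianVariety := fibreHom (serreTranslate ρ E' hE' Pm) x.left
  have hc : c.hom.hom.hom = baseChangeHom (serreTranslate ρ E' hE' Pm) x.left := rfl
  let ρx : 𝓞 F → (((C.𝓜.univ.baseChange (ε.left ≫ pullback.fst C.𝓜.M.hom (bcSpec ℚ Fi))).A.fibre x.left).toAbelianVariety ⟶
      ((C.𝓜.univ.baseChange (ε.left ≫ pullback.fst C.𝓜.M.hom (bcSpec ℚ Fi))).A.fibre x.left).toAbelianVariety) := fun b =>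
    haveI := ρ.isMonHom b
    fibreHom (ρ.i b) x.left
  have hρx : ∀ b : 𝓞 F, (ρx b).hom.hom.hom = (ρ.baseChange x.left).i b := fun b => rfl
  -- (t1′) at `x`: the kernel of `c` on `ℂ`-points is the `𝔞`-torsion (★ `idealKernelLaw_baseChangeHom`)
  have hker : ∀ Pt : ((C.𝓜.univ.baseChange (ε.left ≫ pullback.fst C.𝓜.M.hom (bcSpec ℚ Fi))).A.fibre x.left).toAbelianVariety.Points ℂ,
      AlgPoints.map c.hom.hom.hom Pt = 1 ↔ ∀ b ∈ (𝔞 : Set (𝓞 F)), AlgPoints.map (ρx b).hom.hom.hom Pt = 1 := fun Pt => by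
    simp only [hρx, hc, AlgPoints.map]
    exact AbelianSchemeOver.idealKernelLaw_baseChangeHom x.left ρ (serreTranslate ρ E' hE' Pm) (𝔞 : Set (𝓞 F)) t1' Pt
  -- (surj) at `x`: `c` is onto on `ℂ`-points (surjectivity base-changes; `ℂ` algebraically closed)
  haveI : Surjective (serreTranslate ρ E' hE' Pm).left := ⟨hsurj⟩
  haveI : Surjective (baseChangeHom (serreTranslate ρ E' hE' Pm) x.left).left :=
    AbelianSchemeOver.surjective_baseChangeHom_left x.left (serreTranslate ρ E' hE' Pm)
  -- (finite type of the source, stated over `Spec ℂ` — the point `x.left` has source `(specOver Fᵢ ℂ).left`, definitionally `Spec ℂ`)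
  haveI hft : @LocallyOfFiniteType _ (Spec (CommRingCat.of ℂ))
      ((C.𝓜.univ.baseChange (ε.left ≫ pullback.fst C.𝓜.M.hom (bcSpec ℚ Fi))).A.baseChange x.left).X.hom := by
    haveI := ((C.𝓜.univ.baseChange (ε.left ≫ pullback.fst C.𝓜.M.hom (bcSpec ℚ Fi))).A.baseChange x.left).isSmooth
    have h' : LocallyOfFiniteType ((C.𝓜.univ.baseChange (ε.left ≫ pullback.fst C.𝓜.M.hom (bcSpec ℚ Fi))).A.baseChange x.left).X.hom :=
      inferInstance
    exact h'
  have hsurjC : Function.Surjective (AlgPoints.map (L := ℂ) c.hom.hom.hom :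
      ((C.𝓜.univ.baseChange (ε.left ≫ pullback.fst C.𝓜.M.hom (bcSpec ℚ Fi))).A.fibre x.left).toAbelianVariety.Points ℂ →
        ((serreTensor ρ E' hE').fibre x.left).toAbelianVariety.Points ℂ) := by
    rw [hc]
    exact Literature.AlgebraicGeometry.Motives.AlgPoints.map_surjective_of_surjective_of_isAlgClosed' (k := ℂ) (L := ℂ)
      (baseChangeHom (serreTranslate ρ E' hE' Pm) x.left)
  -- `hread` through `ρx`
  have hread' : ∀ (b : 𝓞 F) (w : Fin C.g ⊕ Fin C.g → ℚ),
      AlgPoints.map (ρx b).hom.hom.hom (m.r w) = m.r (((C.Mρ a b).map (Int.cast : ℤ → ℚ)) *ᵥ w) := fun b w => hread b w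
  -- ★ (S2b) THE ENGINE (p849685): `B_x` is marked by `[J(C.Z a v), r′·ũ]`, the cover reading `id` on `V`
  have heng := SiegelAdelicMarking.exists_marking_of_idealKernel C.hδ (C.Z a v) (C.Z_mem a v hv)
    ((gspRationalToFinAdelic C.δ (C.q a))⁻¹ * C.b a) ((gspRationalToFinAdelic C.δ (C.q a))⁻¹ * C.b a * auxToGspFinV Fr (1, z))
    ((C.𝓜.univ.baseChange (ε.left ≫ pullback.fst C.𝓜.M.hom (bcSpec ℚ Fi))).A.fibre x.left).toAbelianVariety
    ((serreTensor ρ E' hE').fibre x.left).toAbelianVariety m ρx (fun b => (C.Mρ a b).map (Int.cast : ℤ → ℚ)) hread'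
    (𝔞 : Set (𝓞 F)) (fun w hw b hb => hint w hw b hb) (fun w => (hr w).trans (by simp only [SetLike.mem_coe])) c hdim hker hsurjC
  obtain ⟨mB, hmB⟩ := heng
  -- (t4) at `x`: the twisted action reads `C.Mρ a` through `mB`
  have hreadB : ∀ (b : 𝓞 F) (w : Fin C.g ⊕ Fin C.g → ℚ),
      haveI := (serreAction ρ E' hE').isMonHom b
      AlgPoints.map (fibreHom ((serreAction ρ E' hE').i b) x.left).hom.hom.hom (mB.r w) = mB.r (((C.Mρ a b).map (Int.cast : ℤ → ℚ)) *ᵥ w) := by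
    intro b w
    haveI := (serreAction ρ E' hE').isMonHom b
    rw [hmB w, hmB, ← hread' b w]
    simp only [AlgPoints.map, hρx, hc, Category.assoc]
    congr 1
    exact (AbelianSchemeOver.i_baseChange_comp_baseChangeHom x.left ρ (serreAction ρ E' hE') (serreTranslate ρ E' hE' Pm) b (t4 b)).symm
  exact ⟨v, hv, a, k, m, Θ, Λ, mB, hpts, hk, hrepk, hample, hlam, hlvl, hγ, hΨ, hA, hread, hint, hr, hcls, hmB, hreadB⟩

/-! ### §2 THE HEAD AT A PRINCIPAL SIEGEL REPRESENTATIVE: the eight names of (R-CM) ∕ (R-CM-3) ∕ #41 -/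

set_option maxHeartbeats 800000 in -- as §1
/-- **DEAL #42 §2 — THE MARKED SERRE-TENSOR FIBRE AT A PRINCIPAL SIEGEL REPRESENTATIVE.**  Same setting as §1.  There are σ1's representative `(v, a)` of the
flat point with its PRINCIPAL marking `m₀` of `P_x` by `[J(C.Z a v), rep(piece a)]` (ample `Θ`, `IsLambdaOfAt`, level tower read through `rep(piece a)⁻¹`, unit frame,
reading `C.Mρ a` — the `m₁ ∕ hy₁` binders of ★ p850737), and for the twisted fibre `B_x`: a Siegel point `Z₂ ∈ 𝔥_g`, a principal `r₂ ∈ K_δ(1)`, a marking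
`m₂ : SiegelAdelicMarking ⟨J(Z₂), _⟩ r₂ B_x`, rational movers `q′ = (q a)·q_m`, and INTEGER matrices `M₂ b` with: `q′_ℝ⁻¹ (C.J v) q′_ℝ = J(Z₂)`,
`q′_𝔸 • r₂K_δ(N) = (C.b a · ũ_V(1,z))K_δ(N)`, `(M₂ b)_ℚ = q′⁻¹ ρ₀(b) q′`, the twisted action reading `M₂` through `m₂`, and the explicit cover reading
`m₂.r w = (c₀)_x (m₀.r (q_m w))` — the `(v₂ hv₂ a₂ m₂ hr₂ q′ hJ₂ hq′ M₂ hM₂ act₂ hy₂)` binders of ★ `exists_cmConjHom_intertwines_of_centralTwist` at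
`A₂ := B_x`, `act₂ b := ((serreAction ρ E′ hE′).i b)_x`, and the `(hr, hZ, m₂)` datum of (R-CM-3).  Principal representative by ★ `SiegelShimuraSet.exists_eq_mk_jOfSiegel` on
the class `[C.J v, C.b a·ũ]`, mover by ★ `SiegelShimuraSet.mk_eq_mk_iff`, marking by ★ `SiegelAdelicMarking.exists_principal_rationalMove` (★ `rationalMove` + ★ `exists_of_eq`), integrality by ★ `exists_intMatrix_of_reading_of_mem_one`.
[cite: Milne2005ShimuraVarieties, §5 Lemma 5.13 p. 57, §6 Thm. 6.11 pp. 74–75] [cite: Shimura1998, §18.6 pp. 124–127] [cite: Deligne1971TravauxShimura, 4.11–4.12 pp. 148–149] -/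
theorem exists_markedSerreTensorFibre_principal (hΦ : IsCMTypeThrough ι₁ Φ) (C : AuxChartGS F ι₁ Jstar K₀ S Kc Fi τE Φ)
    (ξ : F) (kFr : ℕ) (Fr : SymplecticFrameV F (RingHom.id F) Jstar ((kFr : ℚ) • ξ) C.g C.δ) (hpin : IsChartOfFrame hΦ C ξ kFr Fr)
    (ε : (Literature.AlgebraicGeometry.Motives.baseChange F Fi).obj (S.M.obj Kc) ⟶
        (Literature.AlgebraicGeometry.Motives.baseChange ℚ Fi).obj C.𝓜.M)
    (ρ : AbelianSchemeOver.RingAction (𝓞 F) (C.𝓜.univ.baseChange (ε.left ≫ pullback.fst C.𝓜.M.hom (bcSpec ℚ Fi))).A)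
    [IsCommMonObj (C.𝓜.univ.baseChange (ε.left ≫ pullback.fst C.𝓜.M.hom (bcSpec ℚ Fi))).A.X]
    (hρ : RingActionReading C ε ρ)
    (x : letI : Algebra Fi ℂ := τE.toAlgebra; ComplexPoints ((Literature.AlgebraicGeometry.Motives.baseChange F Fi).obj (S.M.obj Kc)))
    (Pflat : letI : Algebra F ℂ := ι₁.toAlgebra; ComplexPoints (S.M.obj Kc))
    (hx : Pflat.left = x.left ≫ pullback.fst (S.M.obj Kc).hom (bcSpec F Fi))
    (𝔞 : Ideal (𝓞 F)) (h𝔞 : 𝔞 ≠ ⊥) (z : ↥(torusFinAdelic F))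
    (hz : FiniteAdeleRing.toFractionalIdeal (𝓞 F) F (z : (FiniteAdeleRing (𝓞 F) F)ˣ) = ((𝔞 : FractionalIdeal (𝓞 F)⁰ F))⁻¹)
    {mS : ℕ} (E' : Matrix (Fin mS) (Fin mS) (𝓞 F)) (hE' : E' * E' = E') (Pm : Matrix (Fin mS) (Fin 1) (𝓞 F)) (Qm : Matrix (Fin 1) (Fin mS) (𝓞 F))
    {ν : ℕ} (hν : ν ≠ 0) (hP : E' * Pm = Pm) (hQ : Qm * E' = Qm) (hQP : Qm * Pm = Matrix.scalar (Fin 1) ((ν : ℕ) : 𝓞 F))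
    (hPQ : Pm * Qm = Matrix.scalar (Fin mS) ((ν : ℕ) : 𝓞 F) * E') (hspan : Ideal.span (Set.range fun j => Pm j 0) = 𝔞) :
    letI P := C.𝓜.univ.baseChange (ε.left ≫ pullback.fst C.𝓜.M.hom (bcSpec ℚ Fi))
    haveI := isMonHom_serreTranslate ρ E' hE' Pm
    ∃ (v : Fin 2 → ℂ) (hv : v ∈ negCone (Jstar.map ι₁)) (a : GSAdele F Jstar)
      (m₀ : SiegelAdelicMarking ⟨SiegelModuli.jOfSiegel C.δ (C.Z a v), SiegelComplexRecordSystem.jOfSiegel_mem_C0pm C.hδ.1 (C.Z_mem a v hv)⟩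
        (C.rep (C.piece a)) (P.A.fibre x.left).toAbelianVariety)
      (Θ : Literature.AlgebraicGeometry.Motives.CartierDivisor (P.A.fibre x.left).toAbelianVariety.X.left)
      (Λ : P.level.SymplecticLift x.left Θ C.δ)
      (Z₂ : Matrix (Fin C.g) (Fin C.g) ℂ) (hZ₂ : Z₂ ∈ siegelUpperHalfSpace C.g) (r₂ : ↥(gspFinAdelic C.δ))
      (m₂ : SiegelAdelicMarking ⟨SiegelModuli.jOfSiegel C.δ Z₂, SiegelComplexRecordSystem.jOfSiegel_mem_C0pm C.hδ.1 hZ₂⟩ r₂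
        ((serreTensor ρ E' hE').fibre x.left).toAbelianVariety)
      (q' qm : ↥(gspRational C.δ)) (M₂ : 𝓞 F → Matrix (Fin C.g ⊕ Fin C.g) (Fin C.g ⊕ Fin C.g) ℤ),
      -- σ1's principal marking of `P_x` and its readings
      (letI : Algebra F ℂ := ι₁.toAlgebra; S.pts Kc Pflat) = ShimuraSetGS.mk F Jstar ι₁ Kc.1.1 v hv a ∧
      Θ.IsAmple ∧ P.A.IsLambdaOfAt x.left P.D P.pol.lam Θ ∧
      (∀ ⦃M : ℕ⦄, C.N ∣ M → M ≠ 0 → ∀ (y : Fin C.g ⊕ Fin C.g → ZMod M) (w : Fin C.g ⊕ Fin C.g → ℚ),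
        AdelicCongr (((C.rep (C.piece a))⁻¹ : ↥(gspFinAdelic C.δ)) : GL (Fin C.g ⊕ Fin C.g) finAdeleQ) 1 w (fun i => ((y i).val : ℚ) / M) →
          ((Λ.lift M (Multiplicative.ofAdd y)) : (P.A.fibre x.left).toAbelianVariety.Points ℂ) = m₀.r w) ∧
      m₀.γ = 1 ∧ (∀ w : Fin C.g ⊕ Fin C.g → ℝ, m₀.Ψ w = siegelPeriodMap C.δ (C.Z a v) w) ∧
      (P.A.baseChange x.left).IsOfRelDim C.g ∧
      (∀ (b : 𝓞 F) (w : Fin C.g ⊕ Fin C.g → ℚ),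
        haveI := ρ.isMonHom b
        AlgPoints.map (fibreHom (ρ.i b) x.left).hom.hom.hom (m₀.r w) = m₀.r (((C.Mρ a b).map (Int.cast : ℤ → ℚ)) *ᵥ w)) ∧
      -- the twisted fibre at a principal Siegel representative
      r₂ ∈ principalLevelSubgroup C.δ 1 ∧
      q' = C.q a * qm ∧
      conjJ (((gspRationalToReal C.δ q')⁻¹ : ↥(gspReal C.δ)) : GL (Fin C.g ⊕ Fin C.g) ℝ) (C.J v) = SiegelModuli.jOfSiegel C.δ Z₂ ∧
      gspRationalToFinAdelic C.δ q' • ((r₂ : ↥(gspFinAdelic C.δ)) : ↥(gspFinAdelic C.δ) ⧸ principalLevelSubgroup C.δ C.N) =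
        ((C.b a * auxToGspFinV Fr (1, z) : ↥(gspFinAdelic C.δ)) : ↥(gspFinAdelic C.δ) ⧸ principalLevelSubgroup C.δ C.N) ∧
      (∀ b : 𝓞 F, (M₂ b).map (Int.cast : ℤ → ℚ) =
        (((q'⁻¹ : ↥(gspRational C.δ)) : GL (Fin C.g ⊕ Fin C.g) ℚ) : Matrix (Fin C.g ⊕ Fin C.g) (Fin C.g ⊕ Fin C.g) ℚ) * (C.ρ₀ b).map (Int.cast : ℤ → ℚ) *
          (((q' : ↥(gspRational C.δ)) : GL (Fin C.g ⊕ Fin C.g) ℚ) : Matrix (Fin C.g ⊕ Fin C.g) (Fin C.g ⊕ Fin C.g) ℚ)) ∧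
      (∀ (b : 𝓞 F) (w : Fin C.g ⊕ Fin C.g → ℚ),
        haveI := (serreAction ρ E' hE').isMonHom b
        AlgPoints.map (fibreHom ((serreAction ρ E' hE').i b) x.left).hom.hom.hom (m₂.r w) = m₂.r (((M₂ b).map (Int.cast : ℤ → ℚ)) *ᵥ w)) ∧
      (∀ w : Fin C.g ⊕ Fin C.g → ℚ, m₂.r w =
        AlgPoints.map (fibreHom (serreTranslate ρ E' hE' Pm) x.left).hom.hom.hom
          (m₀.r ((((qm : ↥(gspRational C.δ)) : GL (Fin C.g ⊕ Fin C.g) ℚ) : Matrix (Fin C.g ⊕ Fin C.g) (Fin C.g ⊕ Fin C.g) ℚ) *ᵥ w))) := by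
  letI iFi : Algebra Fi ℂ := τE.toAlgebra
  letI iF : Algebra F ℂ := ι₁.toAlgebra
  haveI hc₀ : IsMonHom (serreTranslate ρ E' hE' Pm) := isMonHom_serreTranslate ρ E' hE' Pm
  -- §1
  have h1 := exists_markedSerreTensorFibre hΦ C ξ kFr Fr hpin ε ρ hρ x Pflat hx 𝔞 h𝔞 z hz E' hE' Pm Qm hν hP hQ hQP hPQ hspan
  obtain ⟨v, h1⟩ := h1
  obtain ⟨hv, h1⟩ := h1
  obtain ⟨a, h1⟩ := h1
  obtain ⟨k, h1⟩ := h1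
  obtain ⟨m, h1⟩ := h1
  obtain ⟨Θ, h1⟩ := h1
  obtain ⟨Λ, h1⟩ := h1
  obtain ⟨mB, h1⟩ := h1
  obtain ⟨hpts, hk, hrepk, hample, hlam, hlvl, hγ, hΨ, hA, hread, -, -, -, hmB, hreadB⟩ := h1
  -- σ1's PRINCIPAL marking `m₀` of `P_x` at `rep(piece a) = r′ · k⁻¹` (same lattice, same torsion parametrisation)
  have hk1 : k ∈ principalLevelSubgroup C.δ 1 := principalLevelSubgroup_anti C.δ (one_dvd C.N) hk
  have hbasis : IsLatticeBasis (C.rep (C.piece a)) m.γ := by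
    rw [hrepk]; exact m.γ_isLatticeBasis.mul_of_mem_principalLevelSubgroup_one (inv_mem hk1)
  have hre := m.exists_of_isLatticeBasis hbasis
  obtain ⟨m₀, hγ₀, hΨ₀, -, hm₀⟩ := hre
  -- the twisted fibre's marking moved to a principal Siegel representative (chart՚s `rep_spec`)
  have hN0 : C.N ≠ 0 := by have := C.hN; omega
  have hpm := SiegelAdelicMarking.exists_principal_rationalMove C.hδ hN0 (fun c => (C.rep_spec c).1) (fun c => (C.rep_spec c).2.1)
    (fun c => (C.rep_spec c).2.2.1) (fun c => (C.rep_spec c).2.2.2.1) mB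
  obtain ⟨Z₂, hpm⟩ := hpm
  obtain ⟨hZ₂, hpm⟩ := hpm
  obtain ⟨qm, hpm⟩ := hpm
  obtain ⟨m₂, hpm⟩ := hpm
  obtain ⟨hr₂1, hJm, hm₂w⟩ := hpm
  -- the twisted action reads `qm⁻¹ · (Mρ a b)_ℚ · qm` through `m₂`
  have hqq : (((qm : ↥(gspRational C.δ)) : GL (Fin C.g ⊕ Fin C.g) ℚ) : Matrix (Fin C.g ⊕ Fin C.g) (Fin C.g ⊕ Fin C.g) ℚ) *
      (((qm⁻¹ : ↥(gspRational C.δ)) : GL (Fin C.g ⊕ Fin C.g) ℚ) : Matrix (Fin C.g ⊕ Fin C.g) (Fin C.g ⊕ Fin C.g) ℚ) = 1 := by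
    rw [Subgroup.coe_inv]; exact Units.mul_inv _
  have hy : ∀ (b : 𝓞 F) (w : Fin C.g ⊕ Fin C.g → ℚ),
      haveI := (serreAction ρ E' hE').isMonHom b
      AlgPoints.map (fibreHom ((serreAction ρ E' hE').i b) x.left).hom.hom.hom (m₂.r w) =
        m₂.r ((((((qm⁻¹ : ↥(gspRational C.δ)) : GL (Fin C.g ⊕ Fin C.g) ℚ) : Matrix (Fin C.g ⊕ Fin C.g) (Fin C.g ⊕ Fin C.g) ℚ) *
          (C.Mρ a b).map (Int.cast : ℤ → ℚ) *
          (((qm : ↥(gspRational C.δ)) : GL (Fin C.g ⊕ Fin C.g) ℚ) : Matrix (Fin C.g ⊕ Fin C.g) (Fin C.g ⊕ Fin C.g) ℚ)) *ᵥ w)) := by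
    intro b w
    haveI := (serreAction ρ E' hE').isMonHom b
    rw [hm₂w w, hreadB b]
    refine Eq.trans ?_ (hm₂w _).symm
    congr 1
    simp only [Matrix.mulVec_mulVec, ← Matrix.mul_assoc, hqq, Matrix.one_mul]
  -- … and that reading is INTEGRAL, since `qm_𝔸⁻¹ · r′ũ ∈ K_δ(1)`
  have hint₂ : ∀ b : 𝓞 F, ∃ Mz : Matrix (Fin C.g ⊕ Fin C.g) (Fin C.g ⊕ Fin C.g) ℤ, Mz.map (Int.cast : ℤ → ℚ) =
      (((qm⁻¹ : ↥(gspRational C.δ)) : GL (Fin C.g ⊕ Fin C.g) ℚ) : Matrix (Fin C.g ⊕ Fin C.g) (Fin C.g ⊕ Fin C.g) ℚ) *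
        (C.Mρ a b).map (Int.cast : ℤ → ℚ) *
        (((qm : ↥(gspRational C.δ)) : GL (Fin C.g ⊕ Fin C.g) ℚ) : Matrix (Fin C.g ⊕ Fin C.g) (Fin C.g ⊕ Fin C.g) ℚ) := fun b =>
    haveI := (serreAction ρ E' hE').isMonHom b
    m₂.exists_intMatrix_of_reading_of_mem_one hr₂1 (fibreHom ((serreAction ρ E' hE').i b) x.left) _ (hy b)
  choose Mz hMz using hint₂
  -- assemble the eight names, `q′ := q a · qm`, `r₂ := qm_𝔸⁻¹ · (r′ · ũ)`
  refine ⟨v, hv, a, m₀, Θ, Λ, Z₂, hZ₂, (gspRationalToFinAdelic C.δ qm⁻¹ : ↥(gspFinAdelic C.δ)) *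
      ((gspRationalToFinAdelic C.δ (C.q a))⁻¹ * C.b a * auxToGspFinV Fr (1, z)), m₂, C.q a * qm, qm, Mz, hpts, hample, hlam,
    fun M hM hM0 y w hyw => (hlvl hM hM0 y w hyw).trans (hm₀ w).symm, hγ₀.trans hγ, fun w => by rw [hΨ₀]; exact hΨ w, hA,
    fun b w => ?_, hr₂1, rfl, ?_, ?_, fun b => ?_, fun b w => ?_, fun w => ?_⟩
  · -- `hy₀`: the reading of `ρ_x` through `m₀` (= through `m`)
    haveI := ρ.isMonHom b
    rw [hm₀, hm₀]; exact hread b w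
  · -- `hJ₂`: `(q a · qm)_ℝ⁻¹ (C.J v) (q a · qm)_ℝ = qm_ℝ⁻¹ · J(C.Z a v) · qm_ℝ = J(Z₂)`
    rw [map_mul, _root_.mul_inv_rev, Subgroup.coe_mul, conjJ_mul, (C.q_spec v hv a).1]
    exact hJm
  · -- `hq′`: `(q a · qm)_𝔸 • (qm_𝔸⁻¹ r′ũ) K = (q a)_𝔸 • (r′ũ) K = (C.b a · ũ) K`
    rw [map_mul, mul_smul, MulAction.Quotient.smul_mk, smul_eq_mul, map_inv, mul_inv_cancel_left,
      MulAction.Quotient.smul_mk, smul_eq_mul, mul_assoc, mul_inv_cancel_left]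
  · -- `hM₂`: `(M₂ b)_ℚ = qm⁻¹ (q a)⁻¹ ρ₀(b) (q a) qm = q′⁻¹ ρ₀(b) q′`
    rw [hMz b, C.Mρ_frame v hv a b, _root_.mul_inv_rev, Subgroup.coe_mul, Subgroup.coe_mul, Units.val_mul, Units.val_mul]
    simp only [Matrix.mul_assoc]
  · -- `hy₂`
    haveI := (serreAction ρ E' hE').isMonHom b
    rw [hMz b]; exact hy b w
  · -- `hm₂`: the explicit cover reading against `m₀`
    rw [hm₂w w, hmB, hm₀]

end Summit.HodgeConjecture.HodgeConjecture.Theorems.F0P6aSerreTensorFibreMarkedAtSiegelPoint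

end
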